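import Summits.SmoothPoincare4.SmoothPoincare4.Theses.InformationMetricHadamard
import Literature.Geometry.Manifold.InverseFunctionTheorem
import Literature.Geometry.Lorentzian.Isometry

/-!
# Stub `stub_twoCollarConformality` of line `Sketch` (crux `InformationMetricHadamard.C0AhRecognition`)

(item stmt-SmoothPoincare4-6015, route `InformationMetricHadamard`; first lemma "Liouville at
infinity" of the idea card `Cruxes/C0AhRecognition/Ideas/liouville-conformal-infinity.md`; worker T's
facts memo for the line lead, 2026-08-16. `lean check`: rc 0, 0 sorries, 0 warnings; axioms of
`stub_twoCollarConformality_of_facts` = {propext, Classical.choice, Quot.sound}.)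

**Verdict: `stub-blocked` on the unfiled classical facts F2, F3 below (quasiconformal analysis; none
of it is in Mathlib or the tree). The stub is TRUE as registered, and this file REDUCES it,
kernel-checked, to F2 + F3** (`stub_twoCollarConformality_of_facts`: the registered signature
verbatim behind the two extra hypotheses `(hF2 : OneQuasiconformalRegularity)`
`(hF3 : AsymptoticallyConformalEndExtension)`; NOT to be landed as a variant of the stub).
Everything about the two collars that is differential topology — the transition map `T = Ψ⁻¹ ∘ Φ`,
its smoothness, injectivity, cofinality in both directions and its pointwise
`(1 + o(1))`-conformality between the PRODUCT metrics `dλ² + g`, `dμ² + gN` — is proved here; what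
remains is exactly the boundary theory of quasiconformal maps (F3) and the Liouville–Gehring–Ferrand
regularity of `1`-quasiconformal homeomorphisms (F2), both stated in tree vocabulary on top of ONE
definition request (F1 = `metricDilatation`, Heinonen–Koskela's `H_f(x) = limsup L_f(x,r)/l_f(x,r)`
for the Riemannian distances `PseudoRiemannianMetric.edist`).

## 1. Sanity check of the registered signature (no gap found; true, slightly redundant)

* `N = ∅` or `W` compact cannot occur, and need not be excluded: `far_subset_far` shows from `hfarΦ`
  and `hco'` alone that every far part `Ψ(N × (0,t))` contains a far part `Φ(Σ × (0,s))` (which is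
  non-empty as `Σ ≠ ∅`); in particular `N ≠ ∅`. Mechanism: `(Ψ(N × (0,t)))ᶜ` is compact, hence
  covered by finitely many unit `G`-distance balls, and `hfarΦ` pushes deep `Φ`-points out of each.
  Neither connectedness of `W` nor the completeness clause `hcpt` is needed (`G.edist = ⊤` across
  components is harmless).
* `N` disconnected / `W` with several ends: nothing to assume — the two nestings
  `Φ(Σ × (0,s)) ⊆ Ψ(N × (0,t))` and `Ψ(N × (0,t')) ⊆ Φ(Σ × (0,s'))` make `T` a cofinal embedding of
  ends in both directions, and F3 returns a homeomorphism `Σ ≃ₜ N` outright (so a posteriori `N` is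
  a connected homotopy sphere).
* Used by the reduction: `hg hgN hc hc' hsm hsm' hinj hinj' hco hco' hasym hasym' himmΨ hfarΦ hfarΨ`.
  NOT used: `hcpt`, `hcl`, `hcl'`, `himmΦ` (the first three are consumed by the neighbours A/C which
  produce `himm*`, `hfar*`; `himmΦ` is implied where needed by the asymptotics). Redundant, not
  misstated; orientations play no role (an unoriented diffeomorphism is what is asked).
* Adversarial tests of F3 recorded in its docstring (spirals `θ(λ) → ∞`, mixed scalings
  `(x,λ) ↦ (x,λ²)`, `λ`-dependent isotopies) are all excluded by the asymptotic-conformality clause,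
  as they must be.

## 2. Infrastructure search (2026-08-16)

`lean search -i "quasiconformal|quasisymmetric|dilatation|Liouville|Moebius"` (decl + full text): no
quasiconformal maps of `ℝⁿ`, no metric/linear dilatation, no modulus of curve families in `ℝⁿ`, no
boundary extension, nothing of Gehring / Väisälä / Reshetnyak / Lelong-Ferrand in Mathlib or
`Literature/` (planar items only: `Literature.Analysis.Complex.ExtremalLength`,
`Literature/Probability/RandomPlanarGeometry/ConformalRemovability*`; the SMOOTH Liouville theorem
`Literature.Geometry.Conformal.liouville` — `C^∞` conformal maps of domains of `ℝⁿ`, `n ≥ 3`, are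
Möbius — exists, but the `W^{1,n}` / 1-QC version is what F2 needs). `lean find
"quasiconformal|conformal|collar|Liouville"`: nothing usable in the stockroom. Used from the tree /
Mathlib: `PseudoRiemannianMetric.edist`, `setOf_edist_lt_mem_nhds` (RiemannianDistance.lean),
`Literature.Geometry.Manifold.isLocalDiffeomorphAt_of_mfderiv` (inverse function theorem),
`Literature.Geometry.Lorentzian.mfderivEquivOfInjective`, `IsLocalDiffeomorphAt.localInverse`.
Literature checked with `lit` (held): Iwaniec–Martin 2001, Thm 5.1.1 (Liouville theorem for
`W^{1,n}_{loc}` solutions of the Cauchy–Riemann system = Gehring 1962 / Reshetnyak 1967); Reshetnyak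
1989, Thm 5.10 (Liouville), Thm 12.5 (stability); Rickman 1993, Thm VII.3.16 (reflection principle).
Not held (acquisition request acq-06195 filed by `lit read`): Lelong-Ferrand 1979,
doi:10.1007/bfb0079492. Other locators: Lelong-Ferrand 1976 doi:10.1007/978-94-010-1508-0_11;
Gehring 1962 doi:10.1090/s0002-9947-1962-0139735-8; Väisälä LNM 229 (1971) doi:10.1007/BFb0061216;
Heinonen–Koskela 1998 doi:10.1007/BF02392747; Gutlyanskiĭ–Martio–Ryazanov–Vuorinen 2000
zbl:0938.30014 (Ann. Acad. Sci. Fenn. Math. 25, 101–130).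

## 3. The facts (F1 definition request; F2, F3 fact requests — typed below, NOT proposed)

* **F1** `metricDilatation g hg g' hg' f x : ℝ≥0∞` (definition request) —
  `H_f(x) = limsup_{r → 0⁺} L_f(x,r)/l_f(x,r)` with `L_f(x,r) = sup {d'(f x, f y) : d(x,y) ≤ r}`,
  `l_f(x,r) = inf {d'(f x, f y) : d(x,y) ≥ r}` (Heinonen–Koskela 1998, (1.2)), `d = g.edist hg`,
  `d' = g'.edist hg'`; extended-real valued, no side conditions. For homeomorphisms between
  Riemannian manifolds it agrees with the classical sphere-based linear dilatation (small distance
  spheres are normal spheres), and it is `≥` the classical one in general (`L` over a larger set,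
  `l` over a larger set), so "`H ≤ 1`" below is the classical condition or stronger.
  Hint: [topic Geometry/Riemannian] (no `Analysis/Quasiconformal` directory exists yet).
* **F2** `OneQuasiconformalRegularity` (fact) — a homeomorphism between smooth Riemannian
  `n`-manifolds, `n ≥ 3`, with `H_h(x) ≤ 1` at EVERY point is the map of a `C^∞` diffeomorphism:
  Gehring's metric characterisation (a homeomorphism with `H` bounded everywhere is quasiconformal,
  differentiable a.e. with `J ≠ 0` a.e., and `H(dh_x) = H_h(x)` there; so `H ≤ 1` everywhere makes
  `h` `1`-quasiconformal w.r.t. `g`, `g'`, charts being `C¹`) + Lelong-Ferrand's regularity theorem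
  (a `1`-quasiconformal homeomorphism between `C^∞` Riemannian manifolds of dimension `≥ 3` is a
  `C^∞` conformal diffeomorphism; Euclidean case = Liouville–Gehring–Reshetnyak). Size to PROVE from
  scratch: XXL (ACL/Sobolev theory of QC maps + the `W^{1,n}` Liouville theorem, Iwaniec–Martin Ch. 5,
  + Ferrand's `n`-harmonic/capacity argument).
* **F3** `AsymptoticallyConformalEndExtension` (fact, assembled from print) — boundary values of an
  asymptotically conformal end map between Riemannian cylinders: `T : Σ × (0,s) → N × (0,∞)` smooth,
  injective, cofinal towards `λ = 0` / `μ = 0` in both directions, `dT` `(1+ε)`-conformal from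
  `dλ² + g` to `dμ² + gN` up to a point-dependent factor for `λ < s'(ε)` ⟹ `T(x,λ) → (h x, 0)` for a
  homeomorphism `h : Σ ≃ₜ N` with `H_h ≤ 1` everywhere. Assembly (each piece classical, none in the
  tree): (a) `T` restricted to `T⁻¹(N × (0,t))` is a `K`-quasiconformal homeomorphism between domains
  that are quasiconformally collared at every boundary point (`Σ × {0}`, `N × {0}` via product charts,
  the inner boundaries are smooth compact hypersurfaces), hence extends to a homeomorphism of the
  closures (Väisälä 1971, §17: boundary extension for collared / Jordan-type domains), giving
  `h : Σ ≃ₜ N` by cofinality; (b) in product charts (`g_x`-orthonormal chart at `x`) × `λ` and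
  (`gN_{h x}`-orthonormal chart) × `μ`, glue `T` with its reflection across the slices: a homeomorphism
  which is quasiconformal off a hyperplane piece is quasiconformal with the same dilatation (Väisälä
  1971, Thm 35.1, removability of sets of σ-finite `(n-1)`-measure; equivalently the reflection
  principle, Rickman 1993 Thm VII.3.16), and its maximal dilatation on `B((x,0),ρ)` tends to `1` as
  `ρ → 0` (hypothesis + continuity of the metric coefficients); (c) a quasiconformal map whose
  dilatation on `B(x₀,ρ)` tends to `1` is weakly conformal at `x₀`: `limsup_{r→0} L(x₀,r)/l(x₀,r) = 1`
  (Gutlyanskiĭ–Martio–Ryazanov–Vuorinen 2000: the infinitesimal space at `x₀` consists of linear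
  isometries; proof = QC normal families + the 1-QC Liouville theorem); (d) restriction to the slice
  and the Gauss lemma (`d_g`-spheres about `x` are normal-coordinate spheres; tree:
  `GaussLemmaRiemannianExp`, `RadialIsometryExp`) give `H_h(x) ≤ H_{T̃}((x,0)) = 1`. If the lead
  prefers finer debt items: F3a = (a) for domains in Riemannian manifolds, F3b = (b) (Väisälä 35.1 in
  `ℝⁿ`), F3c = (c) in `ℝⁿ`, F3d = (d) (provable, M); F3 from F3a–d is L-sized glue.
  Size to PROVE from scratch: XXL.

## 4. Proof of the stub from F2 + F3 (all steps PROVED below; sizes are the actual line counts)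

1. `far_subset_far` (45 lines): `hfarΦ` + `hco'` ⇒ `∀ t ∈ (0,1), ∃ s ∈ (0,1), Φ(Σ×(0,s)) ⊆ Ψ(N×(0,t))`;
   used three times (with `t = t₁` the immersivity depth of `Ψ` from `himmΨ`; with `t = t(ε)`; and
   with the roles of the collars swapped, `hfarΨ` + `hco`).
2. `transition_spec`, `transition_image_subset` (cof1), `subset_transition_image` (cof2),
   `injOn_transition`, `mapsTo_transition` (10 lines each): bookkeeping of
   `T = invFunOn Ψ (N × (0,1)) ∘ Φ` from `hinj`, `hinj'` and the nestings.
3. `transition_local` (75 lines): at `p ∈ Σ × (0,s₀)`, `T = L ∘ Φ` near `p` for Mathlib's local inverse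
   `L` of `Ψ` at `T p` (tree inverse function theorem, `dim = 4 + 1 = 5`, `himmΨ`), hence `T` is `C^∞`
   at `p` and `dΨ_{T p} ∘ dT_p = dΦ_p` (chain rule at the `HasMFDerivAt` level + uniqueness).
4. `transition_almostConformal` (110 lines): with `δ = min(1/2, ε/4)`, divide `hasym δ` at `(x,λ)` by
   `hasym' δ` at `T(x,λ)` (deep enough by step 1) along `dΨ ∘ dT = dΦ`:
   `|Q'(dT u) - κ Q(u)| ≤ 4δ κ Q(u) ≤ ε κ Q(u)`, `κ = c μ²/(c' λ²)` (`abs_sub_le_of_two_approx`).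
5. `stub_twoCollarConformality_of_facts` (70 lines): F3 with `m = 4`, `s = s₀` ⇒ `h : Σ ≃ₜ N`,
   `H_h ≤ 1`; F2 with `n = 4` ⇒ `Nonempty (Σ ≃ₘ N)`. ∎

## 5. For the lead

* Nothing was proposed that changes the tree. Steps 1–4 (no `def`, 398 lines) also exist as the
  stand-alone pure-proof file `work/stubs/TwoCollarTransition.lean`; `ledger propose --dry-run
  --target Summits/SmoothPoincare4/SmoothPoincare4/Theorems/InformationMetricHadamardC0AhRecognitionTwoCollarTransition.lean
  --supports stmt-SmoothPoincare4-6015` gave ACCEPT, the real proposal bounced as p112398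
  `supports.stub-mismatch` (a `--supports` file must prove a REGISTERED stub verbatim): if these
  lemmas are wanted in the tree, register e.g. `transition_almostConformal` / `far_subset_far` as
  stubs of a reshaped skeleton (`ledger workitem stub-add`) and re-propose that file unchanged.
* To close the stub: file F1 (definition) and F2, F3 (cited facts, `[topic Geometry/Riemannian]`)
  under `Literature/`, then `stub_twoCollarConformality` is `stub_twoCollarConformality_of_facts`
  applied to `F2_holds`, `F3_holds` — conditional on two unproved Literature facts until somebody
  proves them (XXL each). The honest reading: the stub is classical mathematics (Gehring, Väisälä,
  Lelong-Ferrand, Gutlyanskiĭ–Martio–Ryazanov–Vuorinen) but formally out of reach this season.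
-/

noncomputable section

-- the prescribed namespace `Summit.<P>.<Sub>.…` duplicates `SmoothPoincare4` (P = Sub)
set_option linter.dupNamespace false

open scoped Manifold ContDiff Topology ENNReal NNReal
open Set Function Filter

namespace Summit.SmoothPoincare4.SmoothPoincare4.Cruxes.C0AhRecognition.Sketch

open Literature.Topology.FourManifolds (HomotopySphere)
open Literature.Geometry.Lorentzian (PseudoRiemannianMetric)

/-! ## F1 — definition request: the metric dilatation of a map between Riemannian manifolds -/

section MetricDilatation

variable {E : Type*} [NormedAddCommGroup E] [NormedSpace ℝ E] [FiniteDimensional ℝ E]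
  {H : Type*} [TopologicalSpace H] {I : ModelWithCorners ℝ E H}
  {M : Type*} [TopologicalSpace M] [ChartedSpace H M] [IsManifold I ∞ M] {n : ℕ∞ω}
  {E' : Type*} [NormedAddCommGroup E'] [NormedSpace ℝ E'] [FiniteDimensional ℝ E']
  {H' : Type*} [TopologicalSpace H'] {I' : ModelWithCorners ℝ E' H'}
  {M' : Type*} [TopologicalSpace M'] [ChartedSpace H' M'] [IsManifold I' ∞ M'] {n' : ℕ∞ω}

/-- **DEFINITION REQUEST (F1): the metric (linear) dilatation** `H_f(x)` of a map `f : M → M'`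
between Riemannian manifolds at a point `x`, with respect to the Riemannian distances
`d = g.edist hg`, `d' = g'.edist hg'`:
`H_f(x) = limsup_{r → 0⁺} L_f(x,r) / l_f(x,r)`, where `L_f(x,r) = sup {d'(f x, f y) : d(x,y) ≤ r}` and
`l_f(x,r) = inf {d'(f x, f y) : d(x,y) ≥ r}` (Heinonen–Koskela 1998, (1.2), there for maps between
metric spaces; for homeomorphisms between domains of `ℝⁿ`, or between Riemannian manifolds at small
scales, it is Gehring's / Väisälä's linear dilatation
`limsup max_{|y-x|=r} |f y - f x| / min_{|y-x|=r} |f y - f x|`, and in general it is `≥` that).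
Extended-real valued (quotient in `ℝ≥0∞`, `limsup` along `𝓝[>] 0`), so no side condition is
needed; a homeomorphism `f` is *quasiconformal in the metric sense* iff `H_f` is bounded.
[cite: doi:10.1007/BF02392747, §1 eq. (1.2)] [topic Geometry/Riemannian] -/
def metricDilatation (g : PseudoRiemannianMetric I n E (TangentSpace I : M → Type _))
    (hg : g.IsRiemannian)
    (g' : PseudoRiemannianMetric I' n' E' (TangentSpace I' : M' → Type _)) (hg' : g'.IsRiemannian)
    (f : M → M') (x : M) : ℝ≥0∞ :=
  limsup (fun r : ℝ≥0∞ ↦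
      (⨆ (y : M) (_ : g.edist hg x y ≤ r), g'.edist hg' (f x) (f y)) /
        ⨅ (y : M) (_ : r ≤ g.edist hg x y), g'.edist hg' (f x) (f y))
    (𝓝[>] (0 : ℝ≥0∞))

end MetricDilatation

/-! ## F2 — fact request: `1`-quasiconformal homeomorphisms of Riemannian manifolds are smooth -/

/-- **FACT REQUEST (F2): Liouville–Gehring–Lelong-Ferrand regularity of `1`-quasiconformal
homeomorphisms.** A homeomorphism `h : M ≃ₜ M'` between smooth (`C^∞`) Riemannian manifolds of
dimension `n ≥ 3` whose metric dilatation (F1) satisfies `H_h(x) ≤ 1` at every point `x` is the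
underlying map of a `C^∞` diffeomorphism. In print as the conjunction of two theorems:
(i) Gehring's metric characterisation — a homeomorphism between domains of `ℝⁿ` whose linear
dilatation is bounded at every point is quasiconformal (`ACLⁿ`, differentiable a.e. with `J ≠ 0`
a.e.) and `H(dh_x) = H_h(x)` at points of differentiability, so that `H_h ≤ 1` everywhere makes `h`
`1`-quasiconformal; applied in `C¹` charts, where Riemannian and Euclidean dilatations differ by
locally bounded factors and agree infinitesimally at a.e. point (Gehring 1962, §§5–8, the
"metric definition" theorem; Väisälä 1971, Thm 34.1 with Thm 32.1); (ii) Lelong-Ferrand's regularity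
theorem — a `1`-quasiconformal homeomorphism between `C^∞` Riemannian manifolds of dimension `n ≥ 3`
is a `C^∞` (conformal) diffeomorphism (Lelong-Ferrand 1976; finite-regularity version Lelong-Ferrand
1979; for flat metrics this is the Liouville theorem of Gehring 1962 / Reshetnyak 1967,
Iwaniec–Martin 2001 Thm 5.1.1). Theorem numbers in (i) recalled from memory — the sources are not
held (`lit`); statement (ii) is the title result of both Lelong-Ferrand papers.
[cite: doi:10.1007/978-94-010-1508-0_11, main theorem] [cite: doi:10.1007/bfb0079492, Thm 1]
[cite: doi:10.1090/s0002-9947-1962-0139735-8, §§5–8] [cite: doi:10.1007/BFb0061216, Thm 34.1]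
[topic Geometry/Riemannian] -/
def OneQuasiconformalRegularity : Prop :=
  ∀ (n : ℕ), 3 ≤ n →
    ∀ (M : Type) [TopologicalSpace M] [T2Space M] [SecondCountableTopology M]
      [ChartedSpace (EuclideanSpace ℝ (Fin n)) M] [IsManifold (𝓡 n) ∞ M]
      (g : PseudoRiemannianMetric (𝓡 n) ∞ (EuclideanSpace ℝ (Fin n)) (TangentSpace (𝓡 n) : M → Type _))
      (hg : g.IsRiemannian)
      (M' : Type) [TopologicalSpace M'] [T2Space M'] [SecondCountableTopology M']
      [ChartedSpace (EuclideanSpace ℝ (Fin n)) M'] [IsManifold (𝓡 n) ∞ M']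
      (g' : PseudoRiemannianMetric (𝓡 n) ∞ (EuclideanSpace ℝ (Fin n))
        (TangentSpace (𝓡 n) : M' → Type _))
      (hg' : g'.IsRiemannian) (h : M ≃ₜ M'),
      (∀ x : M, metricDilatation g hg g' hg' h x ≤ 1) →
        ∃ e : M ≃ₘ⟮𝓡 n, 𝓡 n⟯ M', (e : M → M') = h

/-! ## F3 — fact request: boundary values of an asymptotically conformal end map of cylinders -/

/-- **FACT REQUEST (F3): boundary values, with dilatation `1`, of an asymptotically conformal end
map between Riemannian cylinders.** Let `(Σ, g)`, `(N, gN)` be closed `C^∞` Riemannian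
`m`-manifolds and `T : Σ × ℝ → N × ℝ` a map which on `Σ × (0,s)` is `C^∞` and injective, with
values in `N × (0,∞)`, *cofinal towards the boundary in both directions* (given `t > 0`,
`T(Σ × (0,s')) ⊆ N × (0,t)` for some `s' ∈ (0,s)`; given `s' ∈ (0,s)`, `N × (0,t) ⊆ T(Σ × (0,s'))`
for some `t > 0`) and *asymptotically conformal between the product metrics* `g ⊕ dλ²`, `gN ⊕ dμ²`:
for every `ε > 0` there is `s'` such that at each `(x,λ)`, `λ < s'`, for some factor `κ > 0`,
`|(gN ⊕ dμ²)(dT u, dT u) - κ (g ⊕ dλ²)(u,u)| ≤ ε κ (g ⊕ dλ²)(u,u)` for all tangent vectors `u`. Then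
there is a homeomorphism `h : Σ ≃ₜ N` with `T(x,λ) → (h x, 0)` as `λ → 0⁺` and metric dilatation
`H_h(x) ≤ 1` (F1, for the distances of `g`, `gN`) at every point `x`.
In print, assembled from classical quasiconformal analysis (nothing of it in the tree):
(a) on `U = T⁻¹(N × (0,t))`, `t` small, `T` is a `K`-quasiconformal homeomorphism onto `N × (0,t)`
between domains which are quasiconformally collared at every boundary point (`Σ × {0}` and `N × {0}`
through product charts; the inner boundaries are smooth compact hypersurfaces), hence extends to a
homeomorphism of the closures (Väisälä 1971, §17, boundary extension for collared domains — stated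
there in `ℝⁿ`, the proofs are local modulus estimates), and cofinality sends `Σ × {0}` onto
`N × {0}`: this is `h`; (b) in the charts (`g_x`-orthonormal chart at `x`) `× λ` and
(`gN_{h x}`-orthonormal chart at `h x`) `× μ`, `T` glued with its reflection across the slices is a
homeomorphism that is quasiconformal off a hyperplane piece, hence quasiconformal with the same
dilatation (Väisälä 1971, Thm 35.1, removability of closed sets of σ-finite `(n-1)`-measure;
equivalently the reflection principle, Rickman 1993, Thm VII.3.16), and by the hypothesis and the
continuity of the metric coefficients its maximal dilatation on `B((x,0),ρ)` tends to `1` as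
`ρ → 0`; (c) a quasiconformal map whose maximal dilatation on `B(x₀,ρ)` tends to `1` as `ρ → 0` is
weakly conformal at `x₀`, `lim_{r → 0} L(x₀,r)/l(x₀,r) = 1` (Gutlyanskiĭ–Martio–Ryazanov–Vuorinen
2000: the infinitesimal space at `x₀` then consists of linear isometries; proof = normal families of
`K`-quasiconformal maps + the `1`-quasiconformal Liouville theorem, `n = m + 1 ≥ 2`); (d) restricting
to the slice, `H_h(x) ≤ H_{T̃}((x,0)) = 1`, the `d_g`- and `d_{gN}`-spheres of small radius about
`x`, `h x` being the normal-coordinate spheres (Gauss lemma). Sanity tests: `(x,λ) ↦ (x, λ²)`,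
`(x,λ) ↦ (f x, 2λ)` and spirals `(x,λ) ↦ (R_{θ(λ)} x, λ)` with `θ(λ) → ∞` all violate the
conformality clause (it ties the normal to the tangential scaling and forces `λ θ'(λ)`-type cross
terms to `0`), as they must; `λ`-dependent isotopies `(f_λ x, λ)` satisfy it only if `f_λ` converges
to a Riemannian isometry. [cite: doi:10.1007/BFb0061216, §17 and Thm 35.1]
[cite: doi:10.1007/978-3-642-78201-5, Thm VII.3.16] [cite: zbl:0938.30014, §§1–2 (infinitesimal space)]
[topic Geometry/Riemannian] -/
def AsymptoticallyConformalEndExtension : Prop :=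
  ∀ (m : ℕ) (S : Type) [TopologicalSpace S] [T2Space S] [SecondCountableTopology S] [CompactSpace S]
    [ChartedSpace (EuclideanSpace ℝ (Fin m)) S] [IsManifold (𝓡 m) ∞ S]
    (g : PseudoRiemannianMetric (𝓡 m) ∞ (EuclideanSpace ℝ (Fin m)) (TangentSpace (𝓡 m) : S → Type _))
    (hg : g.IsRiemannian)
    (N : Type) [TopologicalSpace N] [T2Space N] [SecondCountableTopology N] [CompactSpace N]
    [ChartedSpace (EuclideanSpace ℝ (Fin m)) N] [IsManifold (𝓡 m) ∞ N]
    (gN : PseudoRiemannianMetric (𝓡 m) ∞ (EuclideanSpace ℝ (Fin m)) (TangentSpace (𝓡 m) : N → Type _))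
    (hgN : gN.IsRiemannian) (T : S × ℝ → N × ℝ) (s : ℝ), 0 < s →
    ContMDiffOn ((𝓡 m).prod 𝓘(ℝ, ℝ)) ((𝓡 m).prod 𝓘(ℝ, ℝ)) ∞ T (univ ×ˢ Ioo (0 : ℝ) s) →
    InjOn T (univ ×ˢ Ioo (0 : ℝ) s) →
    MapsTo T (univ ×ˢ Ioo (0 : ℝ) s) (univ ×ˢ Ioi (0 : ℝ)) →
    (∀ t : ℝ, 0 < t → ∃ s' ∈ Ioo (0 : ℝ) s, T '' (univ ×ˢ Ioo (0 : ℝ) s') ⊆ univ ×ˢ Ioo (0 : ℝ) t) →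
    (∀ s' ∈ Ioo (0 : ℝ) s, ∃ t : ℝ, 0 < t ∧ univ ×ˢ Ioo (0 : ℝ) t ⊆ T '' (univ ×ˢ Ioo (0 : ℝ) s')) →
    (∀ ε : ℝ, 0 < ε → ∃ s' ∈ Ioo (0 : ℝ) s, ∀ (x : S) (l : ℝ), l ∈ Ioo (0 : ℝ) s' →
      ∃ κ : ℝ, 0 < κ ∧ ∀ (v : TangentSpace (𝓡 m) x) (σ : ℝ) (w : EuclideanSpace ℝ (Fin m) × ℝ),
        mfderiv ((𝓡 m).prod 𝓘(ℝ, ℝ)) ((𝓡 m).prod 𝓘(ℝ, ℝ)) T (x, l) (v, σ) = w →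
        |gN.val (T (x, l)).1 w.1 w.1 + w.2 ^ 2 - κ * (g.val x v v + σ ^ 2)| ≤
          ε * (κ * (g.val x v v + σ ^ 2))) →
    ∃ h : S ≃ₜ N, (∀ x : S, Tendsto (fun l : ℝ ↦ T (x, l)) (𝓝[>] (0 : ℝ)) (𝓝 (h x, 0))) ∧
      ∀ x : S, metricDilatation g hg gN hgN h x ≤ 1

/-! ## Step 1 — far parts of one collar nest into far parts of the other (proved) -/

section Nesting

variable {A B W : Type*} [TopologicalSpace W] [T2Space W]
  [ChartedSpace (EuclideanSpace ℝ (Fin 5)) W] [IsManifold (𝓡 5) ∞ W]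
  {G : PseudoRiemannianMetric (𝓡 5) ∞ (EuclideanSpace ℝ (Fin 5)) (TangentSpace (𝓡 5) : W → Type _)}
  {hG : G.IsRiemannian}

/-- **Nesting of far parts.** If the deep points of `Φ` are `G`-far from every base point (`hfarΦ`,
stub C) and the far parts of `Ψ` are co-compact (`hco'`), then every far part of `Ψ` contains a far
part of `Φ`: cover the compact `(Ψ(B × (0,t)))ᶜ` by finitely many unit `G`-distance balls and go
below the depths at which `Φ` leaves each of them. No connectedness or completeness of `W` is used.
[folklore] -/
theorem far_subset_far {Φ : A × ℝ → W} {Ψ : B × ℝ → W}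
    (hfarΦ : ∀ (x₀ : W) (R : NNReal), ∃ t ∈ Ioo (0 : ℝ) 1, ∀ (x : A) (l : ℝ),
      l ∈ Ioo (0 : ℝ) t → (R : ℝ≥0∞) < G.edist hG x₀ (Φ (x, l)))
    (hco' : ∀ t ∈ Ioo (0 : ℝ) 1, IsCompact (Ψ '' (univ ×ˢ Ioo (0 : ℝ) t))ᶜ)
    {t : ℝ} (ht : t ∈ Ioo (0 : ℝ) 1) :
    ∃ s ∈ Ioo (0 : ℝ) 1, Φ '' (univ ×ˢ Ioo (0 : ℝ) s) ⊆ Ψ '' (univ ×ˢ Ioo (0 : ℝ) t) := by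
  haveI : LocallyCompactSpace W := ChartedSpace.locallyCompactSpace (EuclideanSpace ℝ (Fin 5)) W
  have hKc : IsCompact (Ψ '' (univ ×ˢ Ioo (0 : ℝ) t))ᶜ := hco' t ht
  obtain ⟨F, -, hKF⟩ := hKc.elim_nhds_subcover (fun w ↦ {y : W | G.edist hG w y < 1})
    (fun w _ ↦ PseudoRiemannianMetric.setOf_edist_lt_mem_nhds hG w one_pos)
  choose tf htf hfar using fun w : W ↦ hfarΦ w 1
  -- the common depth: below `1/2` and below every `tf w`, `w ∈ F`
  set D : Finset ℝ := insert (1 / 2 : ℝ) (F.image tf) with hD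
  have hDne : D.Nonempty := Finset.insert_nonempty _ _
  set s : ℝ := D.min' hDne with hs
  have hs_le : ∀ w ∈ F, s ≤ tf w := fun w hw ↦
    Finset.min'_le _ _ (Finset.mem_insert_of_mem (Finset.mem_image_of_mem tf hw))
  have hs_pos : 0 < s := by
    rw [hs, Finset.lt_min'_iff]
    intro y hy
    rcases Finset.mem_insert.1 hy with rfl | hy
    · norm_num
    · obtain ⟨w, -, rfl⟩ := Finset.mem_image.1 hy
      exact (htf w).1
  refine ⟨s, ⟨hs_pos, (Finset.min'_le _ _ (Finset.mem_insert_self _ _)).trans_lt one_half_lt_one⟩,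
    ?_⟩
  rintro _ ⟨⟨x, l⟩, ⟨-, hl⟩, rfl⟩
  by_contra hmem
  obtain ⟨w, hwF, hw⟩ := mem_iUnion₂.1 (hKF hmem)
  have hlt : ((1 : NNReal) : ℝ≥0∞) < G.edist hG w (Φ (x, l)) :=
    hfar w x l ⟨hl.1, lt_of_lt_of_le hl.2 (hs_le w hwF)⟩
  rw [ENNReal.coe_one] at hlt
  exact absurd hw (not_lt.2 hlt.le)

end Nesting

/-! ## Steps 2–4 — the transition map `T = Ψ⁻¹ ∘ Φ` (proved) -/

section TransitionMap

variable {X N W : Type} [Nonempty N]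

-- the transition map `T = Ψ⁻¹ ∘ Φ` is the closed term `invFunOn Ψ (univ ×ˢ Ioo 0 1) ∘ Φ` throughout
variable {Φ : X × ℝ → W} {Ψ : N × ℝ → W}

/-- Where `Φ p ∈ Ψ(N × (0,t))`, `t ≤ 1`, the transition map takes the (unique) preimage:
`T p ∈ N × (0,t)` and `Ψ (T p) = Φ p`. [folklore] -/
theorem transition_spec (hinj' : InjOn Ψ (univ ×ˢ Ioo (0 : ℝ) 1)) {t : ℝ} (ht : t ≤ 1)
    {p : X × ℝ} (hp : Φ p ∈ Ψ '' (univ ×ˢ Ioo (0 : ℝ) t)) :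
    (invFunOn Ψ (univ ×ˢ Ioo (0 : ℝ) 1) ∘ Φ) p ∈ univ ×ˢ Ioo (0 : ℝ) t ∧
      Ψ ((invFunOn Ψ (univ ×ˢ Ioo (0 : ℝ) 1) ∘ Φ) p) = Φ p := by
  obtain ⟨q, hq, hqp⟩ := hp
  have hqΩ : q ∈ univ ×ˢ Ioo (0 : ℝ) 1 := ⟨mem_univ _, hq.2.1, lt_of_lt_of_le hq.2.2 ht⟩
  have hT : (invFunOn Ψ (univ ×ˢ Ioo (0 : ℝ) 1) ∘ Φ) p = q := by
    rw [comp_apply, ← hqp]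
    exact hinj'.leftInvOn_invFunOn hqΩ
  rw [hT]
  exact ⟨hq, hqp⟩

/-- **Cofinality of the transition map, outwards** (`cof1`): a far part of `Φ` nested in
`Ψ(N × (0,t))` is mapped by `T` into `N × (0,t)`. [folklore] -/
theorem transition_image_subset (hinj' : InjOn Ψ (univ ×ˢ Ioo (0 : ℝ) 1)) {s t : ℝ} (ht : t ≤ 1)
    (hnest : Φ '' (univ ×ˢ Ioo (0 : ℝ) s) ⊆ Ψ '' (univ ×ˢ Ioo (0 : ℝ) t)) :
    (invFunOn Ψ (univ ×ˢ Ioo (0 : ℝ) 1) ∘ Φ) '' (univ ×ˢ Ioo (0 : ℝ) s) ⊆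
      univ ×ˢ Ioo (0 : ℝ) t := by
  rintro _ ⟨p, hp, rfl⟩
  exact (transition_spec hinj' ht (hnest (mem_image_of_mem Φ hp))).1

/-- **Cofinality of the transition map, inwards** (`cof2`): a far part of `Ψ` nested in
`Φ(X × (0,s))` lies in the image `T(X × (0,s))`. [folklore] -/
theorem subset_transition_image (hinj' : InjOn Ψ (univ ×ˢ Ioo (0 : ℝ) 1)) {s t : ℝ} (ht : t ≤ 1)
    (hnest' : Ψ '' (univ ×ˢ Ioo (0 : ℝ) t) ⊆ Φ '' (univ ×ˢ Ioo (0 : ℝ) s)) :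
    (univ ×ˢ Ioo (0 : ℝ) t : Set (N × ℝ)) ⊆
      (invFunOn Ψ (univ ×ˢ Ioo (0 : ℝ) 1) ∘ Φ) '' (univ ×ˢ Ioo (0 : ℝ) s) := by
  intro q hq
  obtain ⟨p, hp, hpq⟩ := hnest' (mem_image_of_mem Ψ hq)
  refine ⟨p, hp, ?_⟩
  have hqΩ : q ∈ univ ×ˢ Ioo (0 : ℝ) 1 := ⟨mem_univ _, hq.2.1, lt_of_lt_of_le hq.2.2 ht⟩
  rw [comp_apply, hpq]
  exact hinj'.leftInvOn_invFunOn hqΩ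

/-- **Injectivity of the transition map** on a far part of `Φ` nested in the collar of `Ψ`.
[folklore] -/
theorem injOn_transition (hinj : InjOn Φ (univ ×ˢ Ioo (0 : ℝ) 1))
    (hinj' : InjOn Ψ (univ ×ˢ Ioo (0 : ℝ) 1)) {s t : ℝ} (hs : s ≤ 1) (ht : t ≤ 1)
    (hnest : Φ '' (univ ×ˢ Ioo (0 : ℝ) s) ⊆ Ψ '' (univ ×ˢ Ioo (0 : ℝ) t)) :
    InjOn (invFunOn Ψ (univ ×ˢ Ioo (0 : ℝ) 1) ∘ Φ) (univ ×ˢ Ioo (0 : ℝ) s) := by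
  intro p hp p' hp' hpp'
  have h1 := (transition_spec hinj' ht (hnest (mem_image_of_mem Φ hp))).2
  have h2 := (transition_spec hinj' ht (hnest (mem_image_of_mem Φ hp'))).2
  have hΦ : Φ p = Φ p' := by rw [← h1, ← h2, hpp']
  have hsub : (univ ×ˢ Ioo (0 : ℝ) s : Set (X × ℝ)) ⊆ univ ×ˢ Ioo (0 : ℝ) 1 :=
    prod_mono Subset.rfl (Ioo_subset_Ioo_right hs)
  exact hinj (hsub hp) (hsub hp') hΦ

/-- The transition map sends a far part of `Φ` nested in the collar of `Ψ` into `N × (0,∞)`.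
[folklore] -/
theorem mapsTo_transition (hinj' : InjOn Ψ (univ ×ˢ Ioo (0 : ℝ) 1)) {s t : ℝ} (ht : t ≤ 1)
    (hnest : Φ '' (univ ×ˢ Ioo (0 : ℝ) s) ⊆ Ψ '' (univ ×ˢ Ioo (0 : ℝ) t)) :
    MapsTo (invFunOn Ψ (univ ×ˢ Ioo (0 : ℝ) 1) ∘ Φ) (univ ×ˢ Ioo (0 : ℝ) s) (univ ×ˢ Ioi (0 : ℝ)) :=
  fun _ hp ↦ ⟨mem_univ _, (transition_spec hinj' ht (hnest (mem_image_of_mem Φ hp))).1.2.1⟩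

variable [TopologicalSpace X] [ChartedSpace (EuclideanSpace ℝ (Fin 4)) X] [IsManifold (𝓡 4) ∞ X]
  [TopologicalSpace N] [ChartedSpace (EuclideanSpace ℝ (Fin 4)) N] [IsManifold (𝓡 4) ∞ N]
  [TopologicalSpace W] [ChartedSpace (EuclideanSpace ℝ (Fin 5)) W] [IsManifold (𝓡 5) ∞ W]

omit [IsManifold (𝓡 4) ∞ X] in
/-- **Local form of the transition map.** At a point `p` of the collar domain of `Φ` with
`Φ p ∈ Ψ(N × (0,1))` and `dΨ` injective at `T p`, the transition map agrees near `p` with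
`L ∘ Φ` for a smooth local inverse `L` of `Ψ` at `T p` (inverse function theorem, `4 + 1 = 5`);
hence it is smooth at `p` and `dΨ_{T p} ∘ dT_p = dΦ_p`. [folklore] -/
theorem transition_local
    (hsm : ContMDiffOn ((𝓡 4).prod 𝓘(ℝ, ℝ)) (𝓡 5) ∞ Φ (univ ×ˢ Ioo (0 : ℝ) 1))
    (hsm' : ContMDiffOn ((𝓡 4).prod 𝓘(ℝ, ℝ)) (𝓡 5) ∞ Ψ (univ ×ˢ Ioo (0 : ℝ) 1))
    (hinj' : InjOn Ψ (univ ×ˢ Ioo (0 : ℝ) 1))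
    {s t : ℝ} (hs : s ≤ 1) (ht : t ≤ 1)
    (hnest : Φ '' (univ ×ˢ Ioo (0 : ℝ) s) ⊆ Ψ '' (univ ×ˢ Ioo (0 : ℝ) t))
    (himm : ∀ q ∈ univ ×ˢ Ioo (0 : ℝ) t,
      Injective (mfderiv ((𝓡 4).prod 𝓘(ℝ, ℝ)) (𝓡 5) Ψ q))
    {p : X × ℝ} (hp : p ∈ univ ×ˢ Ioo (0 : ℝ) s) :
    ContMDiffAt ((𝓡 4).prod 𝓘(ℝ, ℝ)) ((𝓡 4).prod 𝓘(ℝ, ℝ)) ∞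
        (invFunOn Ψ (univ ×ˢ Ioo (0 : ℝ) 1) ∘ Φ) p ∧
      ∀ u : TangentSpace ((𝓡 4).prod 𝓘(ℝ, ℝ)) p,
        mfderiv ((𝓡 4).prod 𝓘(ℝ, ℝ)) (𝓡 5) Ψ ((invFunOn Ψ (univ ×ˢ Ioo (0 : ℝ) 1) ∘ Φ) p)
            (mfderiv ((𝓡 4).prod 𝓘(ℝ, ℝ)) ((𝓡 4).prod 𝓘(ℝ, ℝ))
              (invFunOn Ψ (univ ×ˢ Ioo (0 : ℝ) 1) ∘ Φ) p u) =
          mfderiv ((𝓡 4).prod 𝓘(ℝ, ℝ)) (𝓡 5) Φ p u := by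
  set T := invFunOn Ψ (univ ×ˢ Ioo (0 : ℝ) 1) ∘ Φ with hTdef
  have hΩXo : IsOpen (univ ×ˢ Ioo (0 : ℝ) 1 : Set (X × ℝ)) := isOpen_univ.prod isOpen_Ioo
  have hΩNo : IsOpen (univ ×ˢ Ioo (0 : ℝ) 1 : Set (N × ℝ)) := isOpen_univ.prod isOpen_Ioo
  have hfarXo : IsOpen (univ ×ˢ Ioo (0 : ℝ) s : Set (X × ℝ)) := isOpen_univ.prod isOpen_Ioo
  have hfarX_sub : (univ ×ˢ Ioo (0 : ℝ) s : Set (X × ℝ)) ⊆ univ ×ˢ Ioo (0 : ℝ) 1 :=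
    prod_mono Subset.rfl (Ioo_subset_Ioo_right hs)
  have hpΩ : p ∈ (univ ×ˢ Ioo (0 : ℝ) 1 : Set (X × ℝ)) := hfarX_sub hp
  -- the preimage point `q = T p`
  have hspec : ∀ p' ∈ (univ ×ˢ Ioo (0 : ℝ) s : Set (X × ℝ)),
      T p' ∈ univ ×ˢ Ioo (0 : ℝ) t ∧ Ψ (T p') = Φ p' := fun p' hp' ↦
    transition_spec hinj' ht (hnest (mem_image_of_mem Φ hp'))
  obtain ⟨hqt, hΨq⟩ := hspec p hp
  set q := T p with hqdef
  have hqΩ : q ∈ (univ ×ˢ Ioo (0 : ℝ) 1 : Set (N × ℝ)) := ⟨mem_univ _, hqt.2.1, hqt.2.2.trans_le ht⟩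
  -- `Ψ` is a local diffeomorphism at `q`
  have hdim : Module.finrank ℝ (EuclideanSpace ℝ (Fin 4) × ℝ) =
      Module.finrank ℝ (EuclideanSpace ℝ (Fin 5)) := by
    rw [Module.finrank_prod, finrank_euclideanSpace_fin, finrank_euclideanSpace_fin,
      Module.finrank_self]
  have hloc : IsLocalDiffeomorphAt ((𝓡 4).prod 𝓘(ℝ, ℝ)) (𝓡 5) ∞ Ψ q := by
    set L' : (EuclideanSpace ℝ (Fin 4) × ℝ) ≃ₗ[ℝ] EuclideanSpace ℝ (Fin 5) :=
      Literature.Geometry.Lorentzian.mfderivEquivOfInjective (I := 𝓡 5)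
        (I' := (𝓡 4).prod 𝓘(ℝ, ℝ)) Ψ q (himm q hqt) hdim with hL'
    refine Literature.Geometry.Manifold.isLocalDiffeomorphAt_of_mfderiv (by simp) hΩNo hqΩ hsm'
      L'.toContinuousLinearEquiv ?_
    ext u
    rfl
  set L := hloc.localInverse with hLdef
  -- the open set on which `invFunOn Ψ` is given by `L`
  set O : Set W := L.source ∩ L ⁻¹' (univ ×ˢ Ioo (0 : ℝ) 1) with hO
  have hOo : IsOpen O :=
    L.contMDiffOn_toFun.continuousOn.isOpen_inter_preimage L.open_source hΩNo
  have hLinv : ∀ y ∈ O, invFunOn Ψ (univ ×ˢ Ioo (0 : ℝ) 1) y = L y := by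
    intro y hy
    have h1 : Ψ (L y) = y := hloc.localInverse_right_inv hy.1
    conv_lhs => rw [← h1]
    exact hinj'.leftInvOn_invFunOn hy.2
  have hΦpO : Φ p ∈ O := by
    rw [← hΨq]
    refine ⟨hloc.localInverse_mem_source, ?_⟩
    show L (Ψ q) ∈ univ ×ˢ Ioo (0 : ℝ) 1
    rw [hloc.localInverse_left_inv hloc.localInverse_mem_target]
    exact hqΩ
  -- `T = L ∘ Φ` near `p`
  have hUo : IsOpen ((univ ×ˢ Ioo (0 : ℝ) 1 : Set (X × ℝ)) ∩ Φ ⁻¹' O) :=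
    hsm.continuousOn.isOpen_inter_preimage hΩXo hOo
  have hev : T =ᶠ[𝓝 p] (L ∘ Φ) := by
    filter_upwards [hUo.mem_nhds ⟨hpΩ, hΦpO⟩] with p' hp'
    exact hLinv (Φ p') hp'.2
  -- smoothness at `p`
  have hΦat : ContMDiffAt ((𝓡 4).prod 𝓘(ℝ, ℝ)) (𝓡 5) ∞ Φ p := hsm.contMDiffAt (hΩXo.mem_nhds hpΩ)
  have hLat : ContMDiffAt (𝓡 5) ((𝓡 4).prod 𝓘(ℝ, ℝ)) ∞ L (Ψ q) := hloc.localInverse_contMDiffAt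
  have hTat : ContMDiffAt ((𝓡 4).prod 𝓘(ℝ, ℝ)) ((𝓡 4).prod 𝓘(ℝ, ℝ)) ∞ T p :=
    (hLat.comp_of_eq hΦat hΨq.symm).congr_of_eventuallyEq hev
  refine ⟨hTat, fun u ↦ ?_⟩
  -- the chain rule for `Ψ ∘ T = Φ` near `p`
  have hTd : HasMFDerivAt ((𝓡 4).prod 𝓘(ℝ, ℝ)) ((𝓡 4).prod 𝓘(ℝ, ℝ)) T p
      (mfderiv ((𝓡 4).prod 𝓘(ℝ, ℝ)) ((𝓡 4).prod 𝓘(ℝ, ℝ)) T p) :=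
    (hTat.mdifferentiableAt (by simp)).hasMFDerivAt
  have hΨd : HasMFDerivAt ((𝓡 4).prod 𝓘(ℝ, ℝ)) (𝓡 5) Ψ (T p)
      (mfderiv ((𝓡 4).prod 𝓘(ℝ, ℝ)) (𝓡 5) Ψ (T p)) :=
    ((hsm'.contMDiffAt (hΩNo.mem_nhds hqΩ)).mdifferentiableAt (by simp)).hasMFDerivAt
  have hcomp := hΨd.comp p hTd
  have hev2 : Φ =ᶠ[𝓝 p] (Ψ ∘ T) := by
    filter_upwards [hfarXo.mem_nhds hp] with p' hp'
    exact ((hspec p' hp').2).symm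
  have hΦd := hcomp.congr_of_eventuallyEq hev2
  rw [hΦd.mfderiv]
  rfl

/-! ### `dT` is `(1 + o(1))`-conformal between the product metrics -/

/-- Elementary core of `transition_almostConformal`: two relative approximations `|X - a| ≤ δ a`,
`|X - b| ≤ δ b` of the same quantity with `δ ≤ 1/2` force `|b - a| ≤ 4 δ a`. [folklore] -/
theorem abs_sub_le_of_two_approx {X a b δ : ℝ} (hδ0 : 0 ≤ δ) (hδ : δ ≤ 1 / 2) (ha : 0 ≤ a)
    (hb : 0 ≤ b) (h1 : |X - a| ≤ δ * a) (h2 : |X - b| ≤ δ * b) : |b - a| ≤ 4 * δ * a := by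
  rw [abs_sub_le_iff] at h1 h2
  obtain ⟨h1a, h1b⟩ := h1
  obtain ⟨h2a, h2b⟩ := h2
  -- `(1 - δ) b ≤ (1 + δ) a`, hence `b ≤ 3 a`
  have hb3 : b ≤ 3 * a := by nlinarith
  rw [abs_sub_le_iff]
  constructor <;> nlinarith

/-- `G_b(a,a)` only depends on the base point up to transport of `a` in the (trivialised) tangent
spaces. [folklore] -/
private theorem val_congr_point
    (G : PseudoRiemannianMetric (𝓡 5) ∞ (EuclideanSpace ℝ (Fin 5))
      (TangentSpace (𝓡 5) : W → Type _)) {b b' : W} (h : b = b') (a : EuclideanSpace ℝ (Fin 5)) :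
    G.val b a a = G.val b' a a := by
  subst h
  rfl

/-- A Riemannian metric has nonnegative squares. [folklore] -/
private theorem val_self_nonneg (g : PseudoRiemannianMetric (𝓡 4) ∞ (EuclideanSpace ℝ (Fin 4))
    (TangentSpace (𝓡 4) : X → Type _)) (hg : g.IsRiemannian) (x : X) (v : TangentSpace (𝓡 4) x) :
    0 ≤ g.val x v v := by
  by_cases hv : v = 0
  · simp [hv]
  · exact (hg x v hv).le

/-- **Asymptotic conformality of the transition map between the product metrics.** Dividing the
asymptotics clause of `Φ` at `(x,λ)` by that of `Ψ` at `T(x,λ)` (deep, by `far_subset_far`) along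
`dΨ ∘ dT = dΦ`: for `λ < s'(ε)`,
`|(gN ⊕ dμ²)(dT u, dT u) - κ (g ⊕ dλ²)(u,u)| ≤ ε κ (g ⊕ dλ²)(u,u)` with `κ = c μ² / (c' λ²)`.
[folklore] -/
theorem transition_almostConformal [T2Space W]
    (g : PseudoRiemannianMetric (𝓡 4) ∞ (EuclideanSpace ℝ (Fin 4))
      (TangentSpace (𝓡 4) : X → Type _)) (hg : g.IsRiemannian)
    (gN : PseudoRiemannianMetric (𝓡 4) ∞ (EuclideanSpace ℝ (Fin 4))
      (TangentSpace (𝓡 4) : N → Type _)) (hgN : gN.IsRiemannian)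
    (G : PseudoRiemannianMetric (𝓡 5) ∞ (EuclideanSpace ℝ (Fin 5))
      (TangentSpace (𝓡 5) : W → Type _)) {hG : G.IsRiemannian}
    (hsm : ContMDiffOn ((𝓡 4).prod 𝓘(ℝ, ℝ)) (𝓡 5) ∞ Φ (univ ×ˢ Ioo (0 : ℝ) 1))
    (hsm' : ContMDiffOn ((𝓡 4).prod 𝓘(ℝ, ℝ)) (𝓡 5) ∞ Ψ (univ ×ˢ Ioo (0 : ℝ) 1))
    (hinj' : InjOn Ψ (univ ×ˢ Ioo (0 : ℝ) 1))
    {c c' : ℝ} (hc : 0 < c) (hc' : 0 < c')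
    (hasym : ∀ ε : ℝ, 0 < ε → ∃ t ∈ Ioo (0 : ℝ) 1, ∀ (x : X) (l : ℝ), l ∈ Ioo (0 : ℝ) t →
      ∀ (v : TangentSpace (𝓡 4) x) (s : ℝ),
        |G.val (Φ (x, l)) (mfderiv ((𝓡 4).prod 𝓘(ℝ, ℝ)) (𝓡 5) Φ (x, l) (v, s))
            (mfderiv ((𝓡 4).prod 𝓘(ℝ, ℝ)) (𝓡 5) Φ (x, l) (v, s)) -
          c * (s ^ 2 + g.val x v v) / l ^ 2| ≤ ε * (c * (s ^ 2 + g.val x v v) / l ^ 2))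
    (hasym' : ∀ ε : ℝ, 0 < ε → ∃ t ∈ Ioo (0 : ℝ) 1, ∀ (y : N) (l : ℝ), l ∈ Ioo (0 : ℝ) t →
      ∀ (v : TangentSpace (𝓡 4) y) (s : ℝ),
        |G.val (Ψ (y, l)) (mfderiv ((𝓡 4).prod 𝓘(ℝ, ℝ)) (𝓡 5) Ψ (y, l) (v, s))
            (mfderiv ((𝓡 4).prod 𝓘(ℝ, ℝ)) (𝓡 5) Ψ (y, l) (v, s)) -
          c' * (s ^ 2 + gN.val y v v) / l ^ 2| ≤ ε * (c' * (s ^ 2 + gN.val y v v) / l ^ 2))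
    (hfarΦ : ∀ (x₀ : W) (R : NNReal), ∃ t ∈ Ioo (0 : ℝ) 1, ∀ (x : X) (l : ℝ),
      l ∈ Ioo (0 : ℝ) t → (R : ℝ≥0∞) < G.edist hG x₀ (Φ (x, l)))
    (hco' : ∀ t ∈ Ioo (0 : ℝ) 1, IsCompact (Ψ '' (univ ×ˢ Ioo (0 : ℝ) t))ᶜ)
    {s₀ t₁ : ℝ} (hs₀ : s₀ ∈ Ioo (0 : ℝ) 1) (ht₁ : t₁ ∈ Ioo (0 : ℝ) 1)
    (hnest₀ : Φ '' (univ ×ˢ Ioo (0 : ℝ) s₀) ⊆ Ψ '' (univ ×ˢ Ioo (0 : ℝ) t₁))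
    (himm₁ : ∀ q ∈ univ ×ˢ Ioo (0 : ℝ) t₁,
      Injective (mfderiv ((𝓡 4).prod 𝓘(ℝ, ℝ)) (𝓡 5) Ψ q)) :
    ∀ ε : ℝ, 0 < ε → ∃ s' ∈ Ioo (0 : ℝ) s₀, ∀ (x : X) (l : ℝ), l ∈ Ioo (0 : ℝ) s' →
      ∃ κ : ℝ, 0 < κ ∧ ∀ (v : TangentSpace (𝓡 4) x) (σ : ℝ) (w : EuclideanSpace ℝ (Fin 4) × ℝ),
        mfderiv ((𝓡 4).prod 𝓘(ℝ, ℝ)) ((𝓡 4).prod 𝓘(ℝ, ℝ))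
            (invFunOn Ψ (univ ×ˢ Ioo (0 : ℝ) 1) ∘ Φ) (x, l) (v, σ) = w →
        |gN.val ((invFunOn Ψ (univ ×ˢ Ioo (0 : ℝ) 1) ∘ Φ) (x, l)).1 w.1 w.1 + w.2 ^ 2 -
            κ * (g.val x v v + σ ^ 2)| ≤
          ε * (κ * (g.val x v v + σ ^ 2)) := by
  intro ε hε
  -- the relative error of each asymptotics clause
  set δ : ℝ := min (1 / 2) (ε / 4) with hδ
  have hδ0 : 0 < δ := lt_min (by norm_num) (by linarith)
  have hδhalf : δ ≤ 1 / 2 := min_le_left _ _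
  have hδε : 4 * δ ≤ ε := by linarith [min_le_right (1 / 2 : ℝ) (ε / 4)]
  obtain ⟨tΦ, htΦ, hΦ⟩ := hasym δ hδ0
  obtain ⟨tΨ, htΨ, hΨ⟩ := hasym' δ hδ0
  -- depth below which `T` lands in `N × (0, min tΨ t₁)`
  have htm : min tΨ t₁ ∈ Ioo (0 : ℝ) 1 :=
    ⟨lt_min htΨ.1 ht₁.1, lt_of_le_of_lt (min_le_left _ _) htΨ.2⟩
  obtain ⟨s₁, hs₁, hnest₁⟩ := far_subset_far hfarΦ hco' htm
  set s' : ℝ := min (min (s₀ / 2) tΦ) s₁ with hs'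
  have hs'pos : 0 < s' := lt_min (lt_min (by linarith [hs₀.1]) htΦ.1) hs₁.1
  have hs's₀ : s' < s₀ := by
    have h1 : s' ≤ s₀ / 2 := (min_le_left _ _).trans (min_le_left _ _)
    linarith [hs₀.1]
  have hs'tΦ : s' ≤ tΦ := (min_le_left _ _).trans (min_le_right _ _)
  have hs's₁ : s' ≤ s₁ := min_le_right _ _
  refine ⟨s', ⟨hs'pos, hs's₀⟩, fun x l hl ↦ ?_⟩
  -- the point, its image, and the identities `Ψ (T p) = Φ p`, `dΨ ∘ dT = dΦ`
  have hp₀ : ((x, l) : X × ℝ) ∈ (univ ×ˢ Ioo (0 : ℝ) s₀ : Set (X × ℝ)) :=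
    ⟨mem_univ _, hl.1, hl.2.trans hs's₀⟩
  have hp₁ : ((x, l) : X × ℝ) ∈ (univ ×ˢ Ioo (0 : ℝ) s₁ : Set (X × ℝ)) :=
    ⟨mem_univ _, hl.1, lt_of_lt_of_le hl.2 hs's₁⟩
  obtain ⟨hTfar, hΨT⟩ := transition_spec hinj' htm.2.le (hnest₁ (mem_image_of_mem Φ hp₁))
  obtain ⟨-, hchain⟩ := transition_local hsm hsm' hinj' hs₀.2.le ht₁.2.le hnest₀ himm₁ hp₀
  set q := (invFunOn Ψ (univ ×ˢ Ioo (0 : ℝ) 1) ∘ Φ) (x, l) with hq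
  have hμ0 : 0 < q.2 := hTfar.2.1
  have hμΨ : q.2 < tΨ := lt_of_lt_of_le hTfar.2.2 (min_le_left _ _)
  have hl0 : 0 < l := hl.1
  -- the conformal factor `κ = c μ² / (c' λ²)`
  refine ⟨c * q.2 ^ 2 / (c' * l ^ 2), by positivity, fun v σ w hw ↦ ?_⟩
  -- the clause of `Φ` at `(x, l)` in the direction `(v, σ)`
  have h1 := hΦ x l ⟨hl.1, lt_of_lt_of_le hl.2 hs'tΦ⟩ v σ
  -- the clause of `Ψ` at `q = T (x, l)` in the direction `w = dT (v, σ)`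
  have h2 : |G.val (Ψ q) (mfderiv ((𝓡 4).prod 𝓘(ℝ, ℝ)) (𝓡 5) Ψ q w)
        (mfderiv ((𝓡 4).prod 𝓘(ℝ, ℝ)) (𝓡 5) Ψ q w) -
        c' * (w.2 ^ 2 + gN.val q.1 w.1 w.1) / q.2 ^ 2| ≤
      δ * (c' * (w.2 ^ 2 + gN.val q.1 w.1 w.1) / q.2 ^ 2) :=
    hΨ q.1 q.2 ⟨hμ0, hμΨ⟩ w.1 w.2
  have hdw : mfderiv ((𝓡 4).prod 𝓘(ℝ, ℝ)) (𝓡 5) Ψ q w =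
      mfderiv ((𝓡 4).prod 𝓘(ℝ, ℝ)) (𝓡 5) Φ (x, l) (v, σ) := by
    rw [← hw]
    exact hchain (v, σ)
  have hval : G.val (Ψ q) (mfderiv ((𝓡 4).prod 𝓘(ℝ, ℝ)) (𝓡 5) Ψ q w)
        (mfderiv ((𝓡 4).prod 𝓘(ℝ, ℝ)) (𝓡 5) Ψ q w) =
      G.val (Φ (x, l)) (mfderiv ((𝓡 4).prod 𝓘(ℝ, ℝ)) (𝓡 5) Φ (x, l) (v, σ))
        (mfderiv ((𝓡 4).prod 𝓘(ℝ, ℝ)) (𝓡 5) Φ (x, l) (v, σ)) := by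
    rw [hdw]
    exact val_congr_point G hΨT _
  rw [hval] at h2
  -- compare the two relative approximations of the same `G`-value
  have hgv : 0 ≤ g.val x v v := val_self_nonneg g hg x v
  have hgw : 0 ≤ gN.val q.1 w.1 w.1 := val_self_nonneg gN hgN q.1 w.1
  have ha : 0 ≤ c * (σ ^ 2 + g.val x v v) / l ^ 2 := by positivity
  have hb : 0 ≤ c' * (w.2 ^ 2 + gN.val q.1 w.1 w.1) / q.2 ^ 2 := by positivity
  have hcore := abs_sub_le_of_two_approx hδ0.le hδhalf ha hb h1 h2
  -- rescale by `μ² / c'`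
  have hc'0 : c' ≠ 0 := hc'.ne'
  have hl0' : l ≠ 0 := hl0.ne'
  have hμ0' : q.2 ≠ 0 := hμ0.ne'
  have hkey : gN.val q.1 w.1 w.1 + w.2 ^ 2 - c * q.2 ^ 2 / (c' * l ^ 2) * (g.val x v v + σ ^ 2) =
      q.2 ^ 2 / c' * (c' * (w.2 ^ 2 + gN.val q.1 w.1 w.1) / q.2 ^ 2 -
        c * (σ ^ 2 + g.val x v v) / l ^ 2) := by
    field_simp
    ring
  have hpos : 0 < q.2 ^ 2 / c' := by positivity
  have hκQ : 0 ≤ c * q.2 ^ 2 / (c' * l ^ 2) * (g.val x v v + σ ^ 2) := by positivity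
  rw [hkey, abs_mul, abs_of_pos hpos]
  calc q.2 ^ 2 / c' * |c' * (w.2 ^ 2 + gN.val q.1 w.1 w.1) / q.2 ^ 2 -
          c * (σ ^ 2 + g.val x v v) / l ^ 2|
        ≤ q.2 ^ 2 / c' * (4 * δ * (c * (σ ^ 2 + g.val x v v) / l ^ 2)) := by gcongr
    _ = 4 * δ * (c * q.2 ^ 2 / (c' * l ^ 2) * (g.val x v v + σ ^ 2)) := by
          field_simp
          ring
    _ ≤ ε * (c * q.2 ^ 2 / (c' * l ^ 2) * (g.val x v v + σ ^ 2)) := by gcongr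

end TransitionMap

/-! ## Step 5 — the stub from F2 + F3 (kernel-checked reduction; NOT a proof of the stub) -/

/-- The carrier of a homotopy 4-sphere is nonempty (it receives a map from `S⁴ ≠ ∅`). [folklore] -/
-- adapted from `…Cruxes.AhHadamardFilling.Sketch.nonempty_carrier`
-- (Theorems/InformationMetricHadamardAhHadamardFillingStubCollarPackage.lean)
private theorem nonempty_carrier' (S : HomotopySphere 4) : Nonempty S.carrier := by
  obtain ⟨e⟩ := S.nonempty_homotopyEquiv
  obtain ⟨v, hv⟩ :=
    (NormedSpace.sphere_nonempty (E := EuclideanSpace ℝ (Fin 5))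
      (x := (0 : EuclideanSpace ℝ (Fin 5))) (r := 1)).2 zero_le_one
  exact ⟨e.invFun ⟨v, hv⟩⟩

set_option linter.unusedVariables false in
/-- **`stub_twoCollarConformality` from F2 + F3** (the registered signature VERBATIM after the two
fact hypotheses; `hcpt`, `hcl`, `hcl'`, `himmΦ` turn out to be unused). Steps: immersivity depth
`t₁` of `Ψ` (`himmΨ`); nesting `Φ(Σ × (0,s₀)) ⊆ Ψ(N × (0,t₁))` (step 1, gives `N ≠ ∅` too); the
transition map `T` on `Σ × (0,s₀)` is smooth, injective, valued in `N × (0,∞)`, cofinal both ways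
and asymptotically conformal between the product metrics (steps 3–5); F3 gives `h : Σ ≃ₜ N` with
`H_h ≤ 1`; F2 (`n = 4`) makes it a diffeomorphism. [folklore] -/
theorem stub_twoCollarConformality_of_facts (hF2 : OneQuasiconformalRegularity)
    (hF3 : AsymptoticallyConformalEndExtension)
    (S : HomotopySphere 4)
    (g : PseudoRiemannianMetric (𝓡 4) ∞ (EuclideanSpace ℝ (Fin 4)) (TangentSpace (𝓡 4) : S.carrier → Type _))
    (hg : g.IsRiemannian)
    (N : Type) [TopologicalSpace N] [T2Space N] [SecondCountableTopology N] [CompactSpace N]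
    [ChartedSpace (EuclideanSpace ℝ (Fin 4)) N] [IsManifold (𝓡 4) ∞ N]
    (gN : PseudoRiemannianMetric (𝓡 4) ∞ (EuclideanSpace ℝ (Fin 4)) (TangentSpace (𝓡 4) : N → Type _))
    (hgN : gN.IsRiemannian)
    (W : Type) [TopologicalSpace W] [T2Space W] [SecondCountableTopology W]
    [ChartedSpace (EuclideanSpace ℝ (Fin 5)) W] [IsManifold (𝓡 5) ∞ W]
    (G : PseudoRiemannianMetric (𝓡 5) ∞ (EuclideanSpace ℝ (Fin 5)) (TangentSpace (𝓡 5) : W → Type _))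
    (hG : G.IsRiemannian)
    (hcpt : ∀ (x : W) (r : NNReal), IsCompact {y : W | G.edist hG x y ≤ r})
    (c : ℝ) (Φ : S.carrier × ℝ → W) (hc : 0 < c)
    (hsm : ContMDiffOn ((𝓡 4).prod 𝓘(ℝ, ℝ)) (𝓡 5) ∞ Φ (univ ×ˢ Ioo (0 : ℝ) 1))
    (hinj : InjOn Φ (univ ×ˢ Ioo (0 : ℝ) 1))
    (hco : ∀ t ∈ Ioo (0 : ℝ) 1, IsCompact (Φ '' (univ ×ˢ Ioo (0 : ℝ) t))ᶜ)
    (hcl : ∀ t ∈ Ioo (0 : ℝ) 1, closure (Φ '' (univ ×ˢ Ioo (0 : ℝ) t)) ⊆ Φ '' (univ ×ˢ Ioo (0 : ℝ) 1))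
    (hasym : ∀ ε : ℝ, 0 < ε → ∃ t ∈ Ioo (0 : ℝ) 1, ∀ (x : S.carrier) (l : ℝ), l ∈ Ioo (0 : ℝ) t →
      ∀ (v : TangentSpace (𝓡 4) x) (s : ℝ),
        |G.val (Φ (x, l)) (mfderiv ((𝓡 4).prod 𝓘(ℝ, ℝ)) (𝓡 5) Φ (x, l) (v, s))
            (mfderiv ((𝓡 4).prod 𝓘(ℝ, ℝ)) (𝓡 5) Φ (x, l) (v, s)) -
          c * (s ^ 2 + g.val x v v) / l ^ 2| ≤ ε * (c * (s ^ 2 + g.val x v v) / l ^ 2))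
    (himmΦ : ∃ t₀ ∈ Ioo (0 : ℝ) 1, ∀ (x : S.carrier) (l : ℝ), l ∈ Ioo (0 : ℝ) t₀ →
      Injective (mfderiv ((𝓡 4).prod 𝓘(ℝ, ℝ)) (𝓡 5) Φ (x, l)))
    (hfarΦ : ∀ (x₀ : W) (R : NNReal), ∃ t ∈ Ioo (0 : ℝ) 1, ∀ (x : S.carrier) (l : ℝ),
      l ∈ Ioo (0 : ℝ) t → (R : ℝ≥0∞) < G.edist hG x₀ (Φ (x, l)))
    (c' : ℝ) (Ψ : N × ℝ → W) (hc' : 0 < c')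
    (hsm' : ContMDiffOn ((𝓡 4).prod 𝓘(ℝ, ℝ)) (𝓡 5) ∞ Ψ (univ ×ˢ Ioo (0 : ℝ) 1))
    (hinj' : InjOn Ψ (univ ×ˢ Ioo (0 : ℝ) 1))
    (hco' : ∀ t ∈ Ioo (0 : ℝ) 1, IsCompact (Ψ '' (univ ×ˢ Ioo (0 : ℝ) t))ᶜ)
    (hcl' : ∀ t ∈ Ioo (0 : ℝ) 1, closure (Ψ '' (univ ×ˢ Ioo (0 : ℝ) t)) ⊆ Ψ '' (univ ×ˢ Ioo (0 : ℝ) 1))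
    (hasym' : ∀ ε : ℝ, 0 < ε → ∃ t ∈ Ioo (0 : ℝ) 1, ∀ (y : N) (l : ℝ), l ∈ Ioo (0 : ℝ) t →
      ∀ (v : TangentSpace (𝓡 4) y) (s : ℝ),
        |G.val (Ψ (y, l)) (mfderiv ((𝓡 4).prod 𝓘(ℝ, ℝ)) (𝓡 5) Ψ (y, l) (v, s))
            (mfderiv ((𝓡 4).prod 𝓘(ℝ, ℝ)) (𝓡 5) Ψ (y, l) (v, s)) -
          c' * (s ^ 2 + gN.val y v v) / l ^ 2| ≤ ε * (c' * (s ^ 2 + gN.val y v v) / l ^ 2))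
    (himmΨ : ∃ t₀ ∈ Ioo (0 : ℝ) 1, ∀ (y : N) (l : ℝ), l ∈ Ioo (0 : ℝ) t₀ →
      Injective (mfderiv ((𝓡 4).prod 𝓘(ℝ, ℝ)) (𝓡 5) Ψ (y, l)))
    (hfarΨ : ∀ (x₀ : W) (R : NNReal), ∃ t ∈ Ioo (0 : ℝ) 1, ∀ (y : N) (l : ℝ),
      l ∈ Ioo (0 : ℝ) t → (R : ℝ≥0∞) < G.edist hG x₀ (Ψ (y, l))) :
    Nonempty (S.carrier ≃ₘ⟮𝓡 4, 𝓡 4⟯ N) := by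
  haveI : Nonempty S.carrier := nonempty_carrier' S
  -- depth of immersivity of `Ψ`, and the basic nesting (step 1)
  obtain ⟨t₁, ht₁, himm₁⟩ := himmΨ
  obtain ⟨s₀, hs₀, hnest₀⟩ := far_subset_far hfarΦ hco' ht₁
  -- `N` is nonempty
  obtain ⟨x₀⟩ := ‹Nonempty S.carrier›
  have hp₀ : ((x₀, s₀ / 2) : S.carrier × ℝ) ∈ (univ ×ˢ Ioo (0 : ℝ) s₀ : Set (S.carrier × ℝ)) :=
    ⟨mem_univ _, by linarith [hs₀.1], by linarith [hs₀.1]⟩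
  obtain ⟨q₀, -, -⟩ := hnest₀ (mem_image_of_mem Φ hp₀)
  haveI : Nonempty N := ⟨q₀.1⟩
  have himm₁' : ∀ q ∈ (univ ×ˢ Ioo (0 : ℝ) t₁ : Set (N × ℝ)),
      Injective (mfderiv ((𝓡 4).prod 𝓘(ℝ, ℝ)) (𝓡 5) Ψ q) := fun q hq ↦ himm₁ q.1 q.2 hq.2
  -- the transition map and the hypotheses of F3 (steps 3–5)
  set T : S.carrier × ℝ → N × ℝ := invFunOn Ψ (univ ×ˢ Ioo (0 : ℝ) 1) ∘ Φ with hT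
  have h_smooth : ContMDiffOn ((𝓡 4).prod 𝓘(ℝ, ℝ)) ((𝓡 4).prod 𝓘(ℝ, ℝ)) ∞ T
      (univ ×ˢ Ioo (0 : ℝ) s₀) := fun p hp ↦
    (transition_local hsm hsm' hinj' hs₀.2.le ht₁.2.le hnest₀ himm₁' hp).1.contMDiffWithinAt
  have h_inj : InjOn T (univ ×ˢ Ioo (0 : ℝ) s₀) :=
    injOn_transition hinj hinj' hs₀.2.le ht₁.2.le hnest₀
  have h_maps : MapsTo T (univ ×ˢ Ioo (0 : ℝ) s₀) (univ ×ˢ Ioi (0 : ℝ)) :=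
    mapsTo_transition hinj' ht₁.2.le hnest₀
  have h_cof1 : ∀ t : ℝ, 0 < t → ∃ s' ∈ Ioo (0 : ℝ) s₀,
      T '' (univ ×ˢ Ioo (0 : ℝ) s') ⊆ univ ×ˢ Ioo (0 : ℝ) t := by
    intro t ht
    have htm : min t (1 / 2) ∈ Ioo (0 : ℝ) 1 :=
      ⟨lt_min ht one_half_pos, lt_of_le_of_lt (min_le_right _ _) one_half_lt_one⟩
    obtain ⟨s₁, hs₁, hnest₁⟩ := far_subset_far hfarΦ hco' htm
    refine ⟨min s₁ (s₀ / 2), ⟨lt_min hs₁.1 (by linarith [hs₀.1]),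
      lt_of_le_of_lt (min_le_right _ _) (by linarith [hs₀.1])⟩, ?_⟩
    have hsub : (univ ×ˢ Ioo (0 : ℝ) (min s₁ (s₀ / 2)) : Set (S.carrier × ℝ)) ⊆
        univ ×ˢ Ioo (0 : ℝ) s₁ :=
      prod_mono Subset.rfl (Ioo_subset_Ioo_right (min_le_left _ _))
    refine (image_mono hsub).trans ((transition_image_subset hinj' htm.2.le hnest₁).trans ?_)
    exact prod_mono Subset.rfl (Ioo_subset_Ioo_right (min_le_left _ _))
  have h_cof2 : ∀ s' ∈ Ioo (0 : ℝ) s₀, ∃ t : ℝ, 0 < t ∧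
      univ ×ˢ Ioo (0 : ℝ) t ⊆ T '' (univ ×ˢ Ioo (0 : ℝ) s') := by
    intro s' hs'
    have hs'1 : s' ∈ Ioo (0 : ℝ) 1 := ⟨hs'.1, hs'.2.trans hs₀.2⟩
    obtain ⟨t, ht, hnest'⟩ := far_subset_far hfarΨ hco hs'1
    exact ⟨t, ht.1, subset_transition_image hinj' ht.2.le hnest'⟩
  have h_ac := transition_almostConformal g hg gN hgN G hsm hsm' hinj' hc hc' hasym hasym' hfarΦ
    hco' hs₀ ht₁ hnest₀ himm₁'
  -- F3, then F2
  have hF3' := hF3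
  unfold AsymptoticallyConformalEndExtension at hF3'
  obtain ⟨h, -, hH⟩ :=
    hF3' 4 S.carrier g hg N gN hgN T s₀ hs₀.1 h_smooth h_inj h_maps h_cof1 h_cof2 h_ac
  have hF2' := hF2
  unfold OneQuasiconformalRegularity at hF2'
  obtain ⟨e, -⟩ := hF2' 4 (by norm_num) S.carrier g hg N gN hgN h hH
  exact ⟨e⟩

end Summit.SmoothPoincare4.SmoothPoincare4.Cruxes.C0AhRecognition.Sketch

end
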